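import Mathlib.RingTheory.Nullstellensatz
import Mathlib.RingTheory.Ideal.KrullsHeightTheorem
import Mathlib.RingTheory.KrullDimension.Field
import Mathlib.RingTheory.KrullDimension.Polynomial
import Mathlib.RingTheory.MvPolynomial.Homogeneous
import Mathlib.RingTheory.MvPolynomial.EulerIdentity
import Mathlib.RingTheory.GradedAlgebra.Radical
import Mathlib.LinearAlgebra.Dual.Lemmas
import Mathlib.Analysis.Complex.Polynomial.Basic
import Literature.RingTheory.KrullDimension.AffineCatenary
import Literature.RingTheory.MvPolynomial.HomogeneousDimension
import Literature.LinearAlgebra.Matrix.RankMinors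
import Literature.AlgebraicGeometry.DeterminantalHypersurfaces.KernerVinnikovSaturation
import Literature.Computability.AlgebraicComplexity.StandardFamilies
import Literature.Computability.AlgebraicComplexity.HessianAtOrigin
import HarnessLib

/-!
# Route GrenetZeon — crux `HessianRankCodimTwo` (stmt-ValiantsHypothesis-8061), line `good_plane`:
# the PLANE CRITERION (stub `stub_planeCriterion`)

The half-rank locus `B_n = {p ∈ Z(per_n) : rank Hess per_n(p) ≤ n²/2}` is the zero set of
HOMOGENEOUS polynomials (`per_n` and the `(⌊n²/2⌋+1)`-minors of the polynomial Hessian matrix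
`(∂_s ∂_t per_n)_{s,t}`), a closed cone.  If a `3`-dimensional linear subspace `W` meets it only in
`0` (a GOOD PLANE), no set cut out by two polynomials — e.g. a non-empty hypersurface section
`Z(per_n) ∩ Z(g)` — lies inside it (projective dimension theorem, here in affine-cone form):

* `exists_common_zero_not_subset_cone` — **cone criterion.** `K` algebraically closed, `T ⊆ K[X_σ]`
  homogeneous polynomials, `W = span(w₁, …, w_c)` (`w` independent) with some `t ∈ T` non-zero at
  every `x ∈ W ∖ 0`; then every finite `G` of FEWER THAN `c` polynomials with a common zero has a
  common zero at which some `t ∈ T` does not vanish.  Proof: a minimal prime `P ⊇ (G)` has height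
  `≤ #G` (Krull); if `Z(G) ⊆ Z(T)` then `T ⊆ √(G) ⊆ P` (Nullstellensatz), so `T` lies in the
  homogeneous core `P*` (a homogeneous prime of height `≤ #G` inside the irrelevant ideal); the
  `N - c` linear forms cutting out `W` generate in the affine domain `K[X] ⧸ P*` (dimension
  `N - ht P*`, dimension formula) an ideal with a minimal prime of height `≤ N - c`, whose quotient
  has dimension `≥ c - #G ≥ 1`; its preimage `Q ⊇ P* + (forms)` is a non-maximal prime, so
  `Z(Q) ⊄ {0}` (Nullstellensatz): a point `x ≠ 0` of `W` with `T(x) = 0` — contradiction.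
* `exists_linearForms_cutting` — a subspace `W ≤ K^σ` is cut out by `card σ - dim W` linear forms.
* `hess0_transl_eq_map`, `eval_det_submatrix_hessMatrix` — the Hessian at a point (and its minors)
  as evaluations of the polynomial Hessian matrix.
* `planeCriterion` — **the registered stub `stub_planeCriterion` of `Lines/good_plane.lean`**, with
  the line's abbreviations `GoodPlane n` / `HalfRankExceeded n p` unfolded (the Cruxes module is not
  importable; the statement is definitionally the registered one and the skeleton closes its
  `sorry` by `exact planeCriterion n h g hg` — checked).

No new definitions; nothing is specific to large `n`.  VP ≠ VNP is not moved by this file (the crux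
only feeds the constant-factor bound `TwoDimCoefficients`; the line's content is `stub_goodPlanes`).
References: Hartshorne, *Algebraic Geometry*, I Thm. 7.2, Ex. 2.10 [Hartshorne1977]; Matsumura,
*Commutative Ring Theory*, Thm. 5.6, 13.5 [Matsumura1987].
-/

noncomputable section

open MvPolynomial

-- `Summit.<Summit>.<Problem>` repeats the name by design (D-0017; lakefile sets it weakly)
set_option linter.dupNamespace false

namespace Summit.ValiantsHypothesis.ValiantsHypothesis.Theorems.GrenetZeon.HessianRankCodimTwo

universe u v

variable {K : Type u} [Field K] {σ : Type v}

/-! ### Linear forms cutting out a subspace -/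

section LinearForms

variable [Fintype σ]

/-- `Σ_m c_m X_m` is a linear form. [folklore] -/
theorem isHomogeneous_sum_C_mul_X (c : σ → K) :
    (∑ m : σ, C (c m) * X m : MvPolynomial σ K).IsHomogeneous 1 :=
  IsHomogeneous.sum _ _ _ fun _ _ => isHomogeneous_C_mul_X _ _

/-- The linear form `Σ_m ψ(e_m) X_m` attached to a functional `ψ` on `K^σ` evaluates to `ψ`.
[folklore] -/
theorem eval_sum_C_apply_single_mul_X [DecidableEq σ] (ψ : Module.Dual K (σ → K)) (x : σ → K) :
    eval x (∑ m : σ, C (ψ (Pi.single m 1)) * X m) = ψ x := by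
  simp only [map_sum, map_mul, eval_C, eval_X]
  have hx : x = ∑ m, x m • (Pi.single m (1 : K) : σ → K) := by
    ext j
    simp [Finset.sum_apply, Pi.single_apply]
  conv_rhs => rw [hx, map_sum]
  refine Finset.sum_congr rfl fun m _ => ?_
  rw [map_smul, smul_eq_mul, mul_comm]

/-- **A linear subspace `W ≤ K^σ` is cut out by at most `card σ - dim W` linear forms**: the forms
attached to a basis of the dual annihilator of `W` (double annihilator,
Mathlib `Subspace.forall_mem_dualAnnihilator_apply_eq_zero_iff`). [folklore] -/
theorem exists_linearForms_cutting (W : Submodule K (σ → K)) :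
    ∃ s : Finset (MvPolynomial σ K),
      s.card + Module.finrank K W ≤ Fintype.card σ ∧ (∀ ℓ ∈ s, ℓ.IsHomogeneous 1) ∧
        ∀ x : σ → K, (∀ ℓ ∈ s, eval x ℓ = 0) → x ∈ W := by
  classical
  haveI : Module.Free K W.dualAnnihilator := Module.Free.of_divisionRing K W.dualAnnihilator
  set t := Module.finrank K W.dualAnnihilator with ht
  let b := Module.finBasis K W.dualAnnihilator
  let L : Fin t → MvPolynomial σ K := fun j =>
    ∑ m : σ, C ((b j : Module.Dual K (σ → K)) (Pi.single m 1)) * X m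
  refine ⟨Finset.univ.image L, ?_, ?_, ?_⟩
  · have h1 : (Finset.univ.image L).card ≤ t :=
      Finset.card_image_le.trans (by simp)
    have h2 : Module.finrank K W + t = Fintype.card σ := by
      rw [ht, Subspace.finrank_add_finrank_dualAnnihilator_eq, Module.finrank_fintype_fun_eq_card]
    omega
  · intro ℓ hℓ
    obtain ⟨j, -, rfl⟩ := Finset.mem_image.1 hℓ
    exact isHomogeneous_sum_C_mul_X _
  · intro x hx
    rw [← Subspace.forall_mem_dualAnnihilator_apply_eq_zero_iff]
    intro φ hφ
    have hb : ∀ j, (b j : Module.Dual K (σ → K)) x = 0 := fun j => by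
      rw [← eval_sum_C_apply_single_mul_X]
      exact hx (L j) (Finset.mem_image_of_mem L (Finset.mem_univ j))
    have hrepr := congrArg Subtype.val (b.sum_repr ⟨φ, hφ⟩)
    simp only [AddSubmonoidClass.coe_finsetSum, SetLike.val_smul] at hrepr
    rw [← hrepr, LinearMap.sum_apply]
    refine Finset.sum_eq_zero fun j _ => ?_
    rw [LinearMap.smul_apply, hb j, smul_zero]

end LinearForms

/-! ### The cone criterion (projective dimension theorem, affine form) -/

section Cone

open Literature.RingTheory.KrullDimension Literature.RingTheory.MvPolynomial

variable [IsAlgClosed K] [Fintype σ]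

/-- **Cone criterion.** Over an algebraically closed field, let `T` be a set of homogeneous
polynomials in the variables `σ` (its zero set is a closed cone `Z(T)`) and let `w₁, …, w_c` be
linearly independent vectors such that at every non-zero point of `span(w)` some member of `T`
does not vanish (`Z(T) ∩ span(w) ⊆ {0}`).  Then for every finite set `G` of fewer than `c`
polynomials having a common zero, some common zero of `G` lies outside `Z(T)` (projective
dimension theorem — `ℙ Z(T)` misses the `(c-1)`-plane `ℙ(span w)`, so `dim Z(T) ≤ N - c` — via
Krull's height theorem, homogeneous cores, the affine dimension formula and the Nullstellensatz).
[cite: Hartshorne1977, I Thm. 7.2 (projective dimension theorem) with I Ex. 2.10 (affine cones)] -/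
theorem exists_common_zero_not_subset_cone (T : Set (MvPolynomial σ K))
    (hT : ∀ t ∈ T, ∃ d, t.IsHomogeneous d) {c : ℕ} {w : Fin c → σ → K}
    (hw : LinearIndependent K w)
    (hgood : ∀ x ∈ Submodule.span K (Set.range w), x ≠ 0 → ∃ t ∈ T, eval x t ≠ 0)
    (G : Finset (MvPolynomial σ K)) (hG : G.card < c)
    (hne : ∃ p : σ → K, ∀ g ∈ G, eval p g = 0) :
    ∃ p : σ → K, (∀ g ∈ G, eval p g = 0) ∧ ∃ t ∈ T, eval p t ≠ 0 := by
  classical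
  letI : GradedAlgebra (homogeneousSubmodule σ K) := MvPolynomial.gradedAlgebra
  by_contra hcon
  push Not at hcon
  obtain ⟨p₀, hp₀⟩ := hne
  -- Step 1: a minimal prime `P` over `(G)`, of height `≤ #G` (Krull)
  have hGle : Ideal.span (G : Set (MvPolynomial σ K)) ≤ vanishingIdeal K ({p₀} : Set (σ → K)) := by
    rw [Ideal.span_le]
    intro g hg
    show g ∈ vanishingIdeal K ({p₀} : Set (σ → K))
    rw [mem_vanishingIdeal_singleton_iff]
    exact hp₀ g hg
  obtain ⟨P, hPmin, -⟩ := Ideal.exists_minimalPrimes_le hGle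
  have hPprime : P.IsPrime := hPmin.1.1
  have hPht : P.height ≤ G.card := Ideal.height_le_card_of_mem_minimalPrimes_span_finset hPmin
  -- Step 2: `T ⊆ P` (Nullstellensatz: `Z(G) ⊆ Z(T)`)
  have hTP : ∀ t ∈ T, t ∈ P := by
    intro t ht
    have hrad : t ∈ (Ideal.span (G : Set (MvPolynomial σ K))).radical := by
      rw [← vanishingIdeal_zeroLocus_eq_radical (K := K), mem_vanishingIdeal_iff]
      intro x hx
      rw [zeroLocus_span] at hx
      exact hcon x (fun g hg => hx g hg) t ht
    exact hPprime.radical_le_iff.2 hPmin.1.2 hrad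
  -- Step 3: the homogeneous core `P*`: a homogeneous prime of height `≤ #G` containing `T`
  set Ps : Ideal (MvPolynomial σ K) := (P.homogeneousCore (homogeneousSubmodule σ K)).toIdeal
    with hPs
  have hPsprime : Ps.IsPrime := hPprime.homogeneousCore
  have hTPs : ∀ t ∈ T, t ∈ Ps := fun t ht => by
    obtain ⟨d, hd⟩ := hT t ht
    exact Ideal.mem_homogeneousCore_of_homogeneous_of_mem
      ⟨d, (mem_homogeneousSubmodule d t).2 hd⟩ (hTP t ht)
  have hPsht : Ps.height ≤ G.card :=
    (Ideal.height_mono (Ideal.toIdeal_homogeneousCore_le _ _)).trans hPht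
  have hPshom : Ps.IsHomogeneous (homogeneousSubmodule σ K) :=
    (P.homogeneousCore (homogeneousSubmodule σ K)).isHomogeneous
  set m₀ : Ideal (MvPolynomial σ K) := RingHom.ker (constantCoeff : MvPolynomial σ K →+* K)
    with hm₀
  have hm₀max : m₀.IsMaximal := isMaximal_ker_constantCoeff
  haveI : m₀.IsPrime := hm₀max.isPrime
  have hPsm₀ : Ps ≤ m₀ := le_ker_constantCoeff_of_isHomogeneous hPshom hPsprime.ne_top
  -- Step 4: linear forms cutting out `span(w)`; they have no constant term
  obtain ⟨s, hscard, hshom, hscut⟩ :=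
    exists_linearForms_cutting (K := K) (Submodule.span K (Set.range w))
  rw [finrank_span_eq_card hw, Fintype.card_fin] at hscard
  have hsm₀ : ∀ ℓ ∈ s, ℓ ∈ m₀ := fun ℓ hℓ => by
    rw [hm₀, RingHom.mem_ker, constantCoeff_eq]
    exact (hshom ℓ hℓ).coeff_eq_zero (d := 0) (by rw [map_zero]; exact zero_ne_one)
  -- Step 5: in the affine domain `A = K[X] ⧸ P*`, a minimal prime `Q'` over the forms
  haveI := hPsprime
  haveI : IsDomain (MvPolynomial σ K ⧸ Ps) := Ideal.Quotient.isDomain Ps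
  set mk := Ideal.Quotient.mk Ps with hmk
  have hmksurj : Function.Surjective mk := Ideal.Quotient.mk_surjective
  set sA : Finset (MvPolynomial σ K ⧸ Ps) := s.image mk with hsA
  have hm₀A : (m₀.map mk).IsPrime := Ideal.isPrime_map_quotientMk_of_isPrime hPsm₀
  have hsAle : Ideal.span (sA : Set (MvPolynomial σ K ⧸ Ps)) ≤ m₀.map mk := by
    rw [Ideal.span_le]
    intro y hy
    obtain ⟨ℓ, hℓ, rfl⟩ := Finset.mem_image.1 (Finset.mem_coe.1 hy)
    exact Ideal.mem_map_of_mem _ (hsm₀ ℓ hℓ)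
  obtain ⟨Q', hQ'min, -⟩ := Ideal.exists_minimalPrimes_le hsAle
  have hQ'prime : Q'.IsPrime := hQ'min.1.1
  have hQ'ht : Q'.height ≤ sA.card := Ideal.height_le_card_of_mem_minimalPrimes_span_finset hQ'min
  have hsAcard : sA.card ≤ s.card := Finset.card_image_le
  -- Step 6: dimension count: `dim A ⧸ Q' ≥ 1`
  haveI : IsDomain ((MvPolynomial σ K ⧸ Ps) ⧸ Q') := Ideal.Quotient.isDomain Q'
  have hdimR : ringKrullDim (MvPolynomial σ K) = (Fintype.card σ : ℕ) := by
    rw [MvPolynomial.ringKrullDim_of_isNoetherianRing, ringKrullDim_eq_zero_of_field,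
      Nat.card_eq_fintype_card, zero_add]
  obtain ⟨dA, hdA, -⟩ := exists_ringKrullDim_eq_and_trdeg_eq K (MvPolynomial σ K ⧸ Ps)
  obtain ⟨dQ, hdQ, -⟩ := exists_ringKrullDim_eq_and_trdeg_eq K ((MvPolynomial σ K ⧸ Ps) ⧸ Q')
  obtain ⟨a, ha⟩ := ENat.ne_top_iff_exists.1
    (ne_top_of_le_ne_top (ENat.coe_ne_top G.card) hPsht)
  obtain ⟨b, hb⟩ := ENat.ne_top_iff_exists.1
    (ne_top_of_le_ne_top (ENat.coe_ne_top sA.card) hQ'ht)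
  have hA := ringKrullDim_quotient_add_height K Ps
  have hB := ringKrullDim_quotient_add_height K Q'
  rw [hdA, ← ha, hdimR] at hA
  rw [hdQ, ← hb, hdA] at hB
  have hA' : dA + a = Fintype.card σ := by
    have h : ((dA + a : ℕ) : WithBot ℕ∞) = ((Fintype.card σ : ℕ) : WithBot ℕ∞) := by
      rw [← hA]; norm_cast
    exact_mod_cast h
  have hB' : dQ + b = dA := by
    have h : ((dQ + b : ℕ) : WithBot ℕ∞) = ((dA : ℕ) : WithBot ℕ∞) := by
      rw [← hB]; norm_cast
    exact_mod_cast h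
  have ha' : a ≤ G.card := by
    have h := hPsht; rw [← ha] at h; exact_mod_cast h
  have hb' : b ≤ sA.card := by
    have h := hQ'ht; rw [← hb] at h; exact_mod_cast h
  -- hence `dim A ⧸ Q' = dQ ≥ 1` and `Q'` is not maximal
  have hQ'notmax : ¬ Q'.IsMaximal := by
    intro hmax
    have h0 := ringKrullDim_eq_zero_of_isField (F := (MvPolynomial σ K ⧸ Ps) ⧸ Q')
      ((Ideal.Quotient.maximal_ideal_iff_isField_quotient Q').1 hmax)
    rw [hdQ] at h0
    have : dQ = 0 := by exact_mod_cast h0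
    omega
  -- Step 7: the preimage `Q` of `Q'`: a non-maximal prime containing `P*` and the forms
  set Q : Ideal (MvPolynomial σ K) := Q'.comap mk with hQ
  haveI hQprime : Q.IsPrime := Ideal.comap_isPrime mk Q'
  have hQnotmax : ¬ Q.IsMaximal := by
    intro hmax
    rcases Ideal.map_eq_top_or_isMaximal_of_surjective mk hmksurj hmax with h | h
    · exact hQ'prime.ne_top (by rwa [hQ, Ideal.map_comap_of_surjective mk hmksurj] at h)
    · exact hQ'notmax (by rwa [hQ, Ideal.map_comap_of_surjective mk hmksurj] at h)
  have hPsQ : Ps ≤ Q := fun t ht => by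
    rw [hQ, Ideal.mem_comap, hmk, Ideal.Quotient.eq_zero_iff_mem.2 ht]
    exact Q'.zero_mem
  have hsQ : ∀ ℓ ∈ s, ℓ ∈ Q := fun ℓ hℓ => by
    rw [hQ, Ideal.mem_comap]
    exact hQ'min.1.2 (Ideal.subset_span (Finset.mem_coe.2 (Finset.mem_image_of_mem mk hℓ)))
  -- Step 8: Nullstellensatz: `Z(Q)` has a non-zero point
  have hQne : Q ≠ m₀ := fun h => hQnotmax (h ▸ hm₀max)
  have hnot : ¬ (zeroLocus K Q ⊆ ({0} : Set (σ → K))) := by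
    intro hsub
    apply hQne
    refine (hm₀max.eq_of_le hQprime.ne_top ?_).symm
    have h1 : vanishingIdeal K ({0} : Set (σ → K)) ≤ vanishingIdeal K (zeroLocus K Q) :=
      vanishingIdeal_anti_mono hsub
    rw [IsPrime.vanishingIdeal_zeroLocus] at h1
    refine le_trans (fun p hp => ?_) h1
    rw [mem_vanishingIdeal_iff]
    intro x hx
    rw [Set.mem_singleton_iff.1 hx, aeval_zero, Algebra.algebraMap_self_apply]
    exact (RingHom.mem_ker).1 hp
  obtain ⟨x, hxQ, hx0⟩ := Set.not_subset.1 hnot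
  rw [mem_zeroLocus_iff] at hxQ
  -- Step 9: `x ∈ span(w) ∖ 0` with `T(x) = 0`: contradiction with the good plane
  have hxW : x ∈ Submodule.span K (Set.range w) := hscut x fun ℓ hℓ => hxQ ℓ (hsQ ℓ hℓ)
  obtain ⟨t, htT, hxt⟩ := hgood x hxW hx0
  exact hxt (hxQ t (hPsQ (hTPs t htT)))

end Cone

/-! ### The Hessian at a point as an evaluation of the polynomial Hessian matrix -/

section Hessian

open Literature.Computability.AlgebraicComplexity

variable {k : Type u} [CommRing k]

/-- The Hessian of `f` at the point `p` (`hess0 (transl p f)`) is the evaluation at `p` of the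
polynomial Hessian matrix `(∂_s ∂_t f)_{s,t}`. [folklore] -/
theorem hess0_transl_eq_map (f : MvPolynomial σ k) (p : σ → k) :
    hess0 (transl p f) = (Matrix.of fun s t : σ => pderiv s (pderiv t f)).map (eval p) := by
  ext s t
  rw [hess0_transl, Matrix.map_apply, Matrix.of_apply]

/-- Minors of the Hessian at `p` are evaluations at `p` of the minors of the polynomial Hessian
matrix. [folklore] -/
theorem eval_det_submatrix_hessMatrix (f : MvPolynomial σ k)
    (p : σ → k) {ι : Type*} [Fintype ι] [DecidableEq ι] (r c : ι → σ) :
    eval p ((Matrix.of fun s t : σ => pderiv s (pderiv t f)).submatrix r c).det =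
      ((hess0 (transl p f)).submatrix r c).det := by
  rw [hess0_transl_eq_map, RingHom.map_det, RingHom.mapMatrix_apply, Matrix.submatrix_map]

/-- The minors of the polynomial Hessian matrix of a form of degree `d` are forms (of degree
`#ι · (d - 1 - 1)`). [folklore] -/
theorem isHomogeneous_det_submatrix_hessMatrix {f : MvPolynomial σ k} {d : ℕ}
    (hf : f.IsHomogeneous d) {ι : Type*} [Fintype ι] [DecidableEq ι] (r c : ι → σ) :
    ((Matrix.of fun s t : σ => pderiv s (pderiv t f)).submatrix r c).det.IsHomogeneous
      (∑ _i : ι, (d - 1 - 1)) :=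
  Literature.AlgebraicGeometry.DeterminantalHypersurfaces.isHomogeneous_det_of_rows
    fun i j => by
      simpa only [Matrix.submatrix_apply, Matrix.of_apply] using (hf.pderiv).pderiv

end Hessian

/-! ### The plane criterion for the permanent (stub `stub_planeCriterion`) -/

section Permanent

open Literature.Computability.AlgebraicComplexity

/-- **Plane criterion (stub `stub_planeCriterion` of line `good_plane`, crux `HessianRankCodimTwo`,
stmt-ValiantsHypothesis-8061), registered signature with `GoodPlane` / `HalfRankExceeded`
unfolded.**  If there are three linearly independent `n × n` matrices `w₁, w₂, w₃` such that at
every non-zero point of their span lying on the permanental hypersurface the Hessian of `per_n`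
has rank `> n²/2`, then every non-empty hypersurface section `Z(per_n) ∩ Z(g)` contains a point
where the Hessian of `per_n` has rank `> n²/2`.  Proof: the cone criterion
`exists_common_zero_not_subset_cone` with `T = {per_n} ∪ {(⌊n²/2⌋+1)-minors of (∂_s∂_t per_n)}`
(homogeneous), `c = 3`, `G = {per_n, g}`; rank `≤ ⌊n²/2⌋` iff all these minors vanish
(`Literature.LinearAlgebra.Matrix.rank_le_iff_det_submatrix_eq_zero`). [folklore] -/
theorem planeCriterion :
    ∀ n : ℕ, (∃ w : Fin 3 → (Fin n × Fin n → ℂ), LinearIndependent ℂ w ∧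
      ∀ a : Fin 3 → ℂ, a ≠ 0 → MvPolynomial.eval (∑ i, a i • w i) (perPoly (Fin n) ℂ) = 0 →
        n ^ 2 < 2 * (hess0 (transl (∑ i, a i • w i) (perPoly (Fin n) ℂ))).rank) →
    ∀ g : MvPolynomial (Fin n × Fin n) ℂ,
      (∃ p : Fin n × Fin n → ℂ, MvPolynomial.eval p (perPoly (Fin n) ℂ) = 0 ∧
        MvPolynomial.eval p g = 0) →
      ∃ p : Fin n × Fin n → ℂ, MvPolynomial.eval p (perPoly (Fin n) ℂ) = 0 ∧
        MvPolynomial.eval p g = 0 ∧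
        n ^ 2 < 2 * (hess0 (transl p (perPoly (Fin n) ℂ))).rank := by
  classical
  intro n ⟨w, hw, hgood⟩ g ⟨p₀, hp₀per, hp₀g⟩
  -- abbreviations
  set per : MvPolynomial (Fin n × Fin n) ℂ := perPoly (Fin n) ℂ with hper
  set k : ℕ := n ^ 2 / 2 with hk
  set H : Matrix (Fin n × Fin n) (Fin n × Fin n) (MvPolynomial (Fin n × Fin n) ℂ) :=
    Matrix.of fun s t => pderiv s (pderiv t per) with hH
  -- rank `> n²/2` iff some `(k+1)`-minor of the Hessian is non-zero
  have hrank : ∀ p : Fin n × Fin n → ℂ,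
      n ^ 2 < 2 * (hess0 (transl p per)).rank ↔
        ∃ (r c : Fin (k + 1) → Fin n × Fin n), eval p ((H.submatrix r c).det) ≠ 0 := by
    intro p
    have h1 : n ^ 2 < 2 * (hess0 (transl p per)).rank ↔ ¬ (hess0 (transl p per)).rank ≤ k := by
      rw [hk]; omega
    rw [h1, Literature.LinearAlgebra.Matrix.rank_le_iff_det_submatrix_eq_zero]
    push Not
    simp only [hH, eval_det_submatrix_hessMatrix]
  -- the cone equations `T = {per} ∪ {minors}`
  set T : Set (MvPolynomial (Fin n × Fin n) ℂ) :=
    insert per (Set.range fun rc : (Fin (k + 1) → Fin n × Fin n) × (Fin (k + 1) → Fin n × Fin n) =>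
      (H.submatrix rc.1 rc.2).det) with hT
  have hThom : ∀ t ∈ T, ∃ d, t.IsHomogeneous d := by
    intro t ht
    rcases Set.mem_insert_iff.1 ht with rfl | ⟨rc, rfl⟩
    · exact ⟨_, perPoly_isHomogeneous⟩
    · exact ⟨_, isHomogeneous_det_submatrix_hessMatrix perPoly_isHomogeneous rc.1 rc.2⟩
  -- the good plane: on `span(w) ∖ 0`, some member of `T` does not vanish
  have hgood' : ∀ x ∈ Submodule.span ℂ (Set.range w), x ≠ 0 → ∃ t ∈ T, eval x t ≠ 0 := by
    intro x hx hx0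
    obtain ⟨a, rfl⟩ := (Submodule.mem_span_range_iff_exists_fun ℂ).1 hx
    have ha : a ≠ 0 := by rintro rfl; exact hx0 (by simp)
    by_cases hpx : eval (∑ i, a i • w i) per = 0
    · obtain ⟨r, c, hrc⟩ := (hrank _).1 (hgood a ha hpx)
      exact ⟨_, Set.mem_insert_of_mem _ ⟨(r, c), rfl⟩, hrc⟩
    · exact ⟨per, Set.mem_insert _ _, hpx⟩
  -- the two equations `G = {per, g}`
  obtain ⟨p, hpG, t, htT, hpt⟩ := exists_common_zero_not_subset_cone T hThom hw hgood'
    ({per, g} : Finset _) (lt_of_le_of_lt (Finset.card_insert_le _ _) (by simp))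
    ⟨p₀, by
      intro q hq
      rcases Finset.mem_insert.1 hq with rfl | hq
      · exact hp₀per
      · rw [Finset.mem_singleton.1 hq]; exact hp₀g⟩
  have hpper : eval p per = 0 := hpG per (Finset.mem_insert_self _ _)
  have hpg : eval p g = 0 := hpG g (Finset.mem_insert_of_mem (Finset.mem_singleton_self _))
  refine ⟨p, hpper, hpg, ?_⟩
  rcases Set.mem_insert_iff.1 htT with rfl | ⟨rc, rfl⟩
  · exact absurd hpper hpt
  · exact (hrank p).2 ⟨rc.1, rc.2, hpt⟩

end Permanent

end Summit.ValiantsHypothesis.ValiantsHypothesis.Theorems.GrenetZeon.HessianRankCodimTwo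

end
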